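import Summits.SmoothPoincare4.SmoothPoincare4.Theses.EntropyRung
import Summits.SmoothPoincare4.SmoothPoincare4.Theorems.EntropyRungSubcylindricalExistenceLogCutoff
import Summits.SmoothPoincare4.SmoothPoincare4.Theorems.SymplecticOrigamiGromovRecognitionRelEndStubTameMoserAux4
import HarnessLib

/-!
# The one-variable telescoping cut-off family of a geometric grid of log-radii
(crux stmt-SmoothPoincare4-10871 `EntropyRung.SubcylindricalExistence`, line
`fat-conical-core-avr-logsobolev`, aux helper `helper_cutoffFamily_profiles` for the stub
`helper_cutoffFamily` (H-cut) of lead c4's skeleton)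

Pure real analysis. Data: a zone length `ℓ₀ ≥ 1`, a grid step `d ≥ ℓ₀`, an origin `T₀` and
`N ≥ 2`. The zones are `[aᵢ, aᵢ + ℓ₀]`, `aᵢ = T₀ + i d` (`i < N`); consecutive zones do not overlap
(`aᵢ + ℓ₀ ≤ aᵢ₊₁`). With the smooth step `η = Real.smoothTransition` (`0` on `(-∞, 0]`, `1` on
`[1, ∞)`) put `θᵢ(t) = η((t − aᵢ)/ℓ₀)`, `cᵢ = cos(π θᵢ / 2)`, `sᵢ = sin(π θᵢ / 2)`, and

  `F₀ = c₀`,  `Fⱼ = sⱼ₋₁ cⱼ` (`0 < j < N`),  `Fⱼ = s_{N−1}` (`j ≥ N`).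

Since `θᵢ₊₁(t) ≠ 0` forces `θᵢ(t) = 1`, the partial sums telescope:
`Σ_{j ≤ k} Fⱼ² = cₖ²` for `k < N`, whence `Σ_{j ≤ N} Fⱼ² = c²_{N−1} + s²_{N−1} = 1`. The family is
smooth, `F₀ = 1`, `Fⱼ = 0` (`j > 0`) on `(-∞, T₀]`, `F_N = 1`, `Fⱼ = 0` (`j < N`) on
`[a_{N−1} + ℓ₀, ∞)`, the supports and the supports of the derivatives lie in the expected zones,
and `(Fⱼ')² ≤ (π² B² + 1)/ℓ₀²` with `B = sup |η'|`
(`LogCutoff.exists_abs_deriv_smoothTransition_le`; the support of `η'` lies in `[0, 1]` by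
`GromovRecognitionRelEnd.CrossCapLaurent.deriv_smoothTransition_of_neg/of_one_lt`). Everything is
proved; no definition, no named fact.

References: R. Schoen, S.-T. Yau, *On the proof of the positive mass conjecture in general
relativity* (1979), §2 (logarithmic cut-offs); standard partition-of-unity algebra. [folklore]
-/

noncomputable section

open scoped ContDiff Topology
open Set Filter

-- the registered namespace `Summit.SmoothPoincare4.SmoothPoincare4.Theorems` repeats a component
set_option linter.dupNamespace false

namespace Summit.SmoothPoincare4.SmoothPoincare4.Theorems

namespace HelperCutoffFamilyAux

/-! ### The steps `θ(t) = η((t − a)/ℓ)` of a zone `[a, a + ℓ]` -/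

section Step

variable {a ℓ t : ℝ}

/-- The step vanishes before the zone. [folklore] -/
theorem step_eq_zero (hℓ : 0 < ℓ) (ht : t ≤ a) : Real.smoothTransition ((t - a) / ℓ) = 0 :=
  Real.smoothTransition.zero_of_nonpos (div_nonpos_iff.2 (Or.inr ⟨sub_nonpos.2 ht, hℓ.le⟩))

/-- The step is `1` after the zone. [folklore] -/
theorem step_eq_one (hℓ : 0 < ℓ) (ht : a + ℓ ≤ t) : Real.smoothTransition ((t - a) / ℓ) = 1 :=
  Real.smoothTransition.one_of_one_le ((le_div_iff₀ hℓ).2 (by linarith))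

/-- Where the step is nonzero we are past the start of the zone. [folklore] -/
theorem lt_of_step_ne_zero (hℓ : 0 < ℓ) (h : Real.smoothTransition ((t - a) / ℓ) ≠ 0) : a < t :=
  not_le.mp fun ht ↦ h (step_eq_zero hℓ ht)

/-- Where the step is not `1` we are before the end of the zone. [folklore] -/
theorem lt_of_step_ne_one (hℓ : 0 < ℓ) (h : Real.smoothTransition ((t - a) / ℓ) ≠ 1) :
    t < a + ℓ :=
  not_le.mp fun ht ↦ h (step_eq_one hℓ ht)

/-- Where `η'((t − a)/ℓ) ≠ 0` the point `t` lies in the closed zone `[a, a + ℓ]` (`η'` vanishes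
on `(-∞, 0)` and on `(1, ∞)`: `GromovRecognitionRelEnd.CrossCapLaurent.deriv_smoothTransition_of_neg`
and `…_of_one_lt` of the tree). [folklore] -/
theorem mem_zone_of_deriv_ne_zero (hℓ : 0 < ℓ)
    (h : deriv Real.smoothTransition ((t - a) / ℓ) ≠ 0) : a ≤ t ∧ t ≤ a + ℓ := by
  constructor
  · exact not_lt.mp fun hlt ↦ h (GromovRecognitionRelEnd.CrossCapLaurent.deriv_smoothTransition_of_neg
      (div_neg_of_neg_of_pos (sub_neg.2 hlt) hℓ))
  · exact not_lt.mp fun hlt ↦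
      h (GromovRecognitionRelEnd.CrossCapLaurent.deriv_smoothTransition_of_one_lt
        ((one_lt_div hℓ).2 (by linarith)))

/-- The step is smooth. [folklore] -/
theorem contDiff_step (a ℓ : ℝ) :
    ContDiff ℝ ∞ (fun t ↦ Real.smoothTransition ((t - a) / ℓ)) :=
  (Real.smoothTransition.contDiff (n := ⊤)).comp ((contDiff_id.sub contDiff_const).div_const ℓ)

/-- `cos(π θ / 2)` is smooth. [folklore] -/
theorem contDiff_cos_step (a ℓ : ℝ) :
    ContDiff ℝ ∞ (fun t ↦ Real.cos (Real.pi / 2 * Real.smoothTransition ((t - a) / ℓ))) :=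
  (contDiff_const.mul (contDiff_step a ℓ)).cos

/-- `sin(π θ / 2)` is smooth. [folklore] -/
theorem contDiff_sin_step (a ℓ : ℝ) :
    ContDiff ℝ ∞ (fun t ↦ Real.sin (Real.pi / 2 * Real.smoothTransition ((t - a) / ℓ))) :=
  (contDiff_const.mul (contDiff_step a ℓ)).sin

/-- The derivative of the step (chain rule). [folklore] -/
theorem hasDerivAt_step (a ℓ t : ℝ) :
    HasDerivAt (fun t ↦ Real.smoothTransition ((t - a) / ℓ))
      (deriv Real.smoothTransition ((t - a) / ℓ) * (1 / ℓ)) t :=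
  ((Real.smoothTransition.contDiff (n := ⊤)).differentiable (by simp)).differentiableAt.hasDerivAt.comp
    t (((hasDerivAt_id' t).sub_const a).div_const ℓ)

/-- The derivative of `cos(π θ / 2)`. [folklore] -/
theorem hasDerivAt_cos_step (a ℓ t : ℝ) :
    HasDerivAt (fun t ↦ Real.cos (Real.pi / 2 * Real.smoothTransition ((t - a) / ℓ)))
      (-Real.sin (Real.pi / 2 * Real.smoothTransition ((t - a) / ℓ)) *
        (Real.pi / 2 * (deriv Real.smoothTransition ((t - a) / ℓ) * (1 / ℓ)))) t :=
  ((hasDerivAt_step a ℓ t).const_mul (Real.pi / 2)).cos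

/-- The derivative of `sin(π θ / 2)`. [folklore] -/
theorem hasDerivAt_sin_step (a ℓ t : ℝ) :
    HasDerivAt (fun t ↦ Real.sin (Real.pi / 2 * Real.smoothTransition ((t - a) / ℓ)))
      (Real.cos (Real.pi / 2 * Real.smoothTransition ((t - a) / ℓ)) *
        (Real.pi / 2 * (deriv Real.smoothTransition ((t - a) / ℓ) * (1 / ℓ)))) t :=
  ((hasDerivAt_step a ℓ t).const_mul (Real.pi / 2)).sin

/-- The bound `|π/2 · η'(u)/ℓ| ≤ (π/2) B/ℓ`. [folklore] -/
theorem abs_dstep_le {B : ℝ} (hB : ∀ y, |deriv Real.smoothTransition y| ≤ B) (hℓ : 0 < ℓ)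
    (u : ℝ) : |Real.pi / 2 * (deriv Real.smoothTransition u * (1 / ℓ))| ≤ Real.pi / 2 * B / ℓ := by
  rw [abs_mul, abs_of_pos (by positivity : 0 < Real.pi / 2), abs_mul,
    abs_of_pos (by positivity : 0 < 1 / ℓ)]
  calc Real.pi / 2 * (|deriv Real.smoothTransition u| * (1 / ℓ))
      ≤ Real.pi / 2 * (B * (1 / ℓ)) := by gcongr; exact hB u
    _ = Real.pi / 2 * B / ℓ := by ring

end Step

/-- `|-sin φ · X| ≤ |X|` and `|cos φ · X| ≤ |X|`. [folklore] -/
theorem abs_trig_mul_le (φ X : ℝ) : |-Real.sin φ * X| ≤ |X| ∧ |Real.cos φ * X| ≤ |X| := by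
  constructor
  · rw [abs_mul, abs_neg]
    exact mul_le_of_le_one_left (abs_nonneg X) (Real.abs_sin_le_one φ)
  · rw [abs_mul]
    exact mul_le_of_le_one_left (abs_nonneg X) (Real.abs_cos_le_one φ)

/-- **The telescoping identity.** If `u (i+1) ≠ 0` forces `u i = 1`, then
`cos²(π u₀/2) + Σ_{0<j<N} sin²(π u_{j−1}/2) cos²(π uⱼ/2) + sin²(π u_{N−1}/2) = 1`. [folklore] -/
theorem sum_sq_telescope (N : ℕ) (u : ℕ → ℝ) (hN : 1 ≤ N) (hu : ∀ i, u (i + 1) ≠ 0 → u i = 1) :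
    ∑ j ∈ Finset.range (N + 1),
      (if j = 0 then Real.cos (Real.pi / 2 * u 0)
        else if j < N then Real.sin (Real.pi / 2 * u (j - 1)) * Real.cos (Real.pi / 2 * u j)
        else Real.sin (Real.pi / 2 * u (N - 1))) ^ 2 = 1 := by
  have key : ∀ k, k + 1 ≤ N → ∑ j ∈ Finset.range (k + 1),
      (if j = 0 then Real.cos (Real.pi / 2 * u 0)
        else if j < N then Real.sin (Real.pi / 2 * u (j - 1)) * Real.cos (Real.pi / 2 * u j)
        else Real.sin (Real.pi / 2 * u (N - 1))) ^ 2 = Real.cos (Real.pi / 2 * u k) ^ 2 := by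
    intro k
    induction k with
    | zero => intro _; simp
    | succ k ih =>
      intro hk
      rw [Finset.sum_range_succ, ih (by omega)]
      have h1 : k + 1 ≠ 0 := by omega
      have h2 : k + 1 < N := by omega
      simp only [h1, ↓reduceIte, h2, Nat.add_sub_cancel]
      by_cases h0 : u (k + 1) = 0
      · rw [h0, mul_zero, Real.cos_zero, mul_one, Real.cos_sq_add_sin_sq, one_pow]
      · rw [hu k h0, mul_one, Real.cos_pi_div_two, Real.sin_pi_div_two]
        ring
  obtain ⟨K, rfl⟩ : ∃ K, N = K + 1 := ⟨N - 1, by omega⟩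
  rw [Finset.sum_range_succ, key K le_rfl]
  have h1 : K + 1 ≠ 0 := by omega
  simp only [h1, ↓reduceIte, lt_irrefl, Nat.add_sub_cancel, Real.cos_sq_add_sin_sq]

end HelperCutoffFamilyAux

/-- **The one-variable telescoping cut-off family** (aux helper `helper_cutoffFamily_profiles`
of the stub `helper_cutoffFamily`, line `fat-conical-core-avr-logsobolev`). A universal `C₁ > 0`
such that for `1 ≤ ℓ₀ ≤ d`, `2 ≤ N` and every `T₀` there are smooth `Fⱼ : ℝ → ℝ` (`j : ℕ`) with
`Σ_{j ≤ N} Fⱼ² = 1`; `F₀ = 1`, `Fⱼ = 0` (`j > 0`) on `(-∞, T₀]`; `F_N = 1`, `Fⱼ = 0` (`j < N`) on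
`[T₀ + (N−1)d + ℓ₀, ∞)`; `F₀ ≠ 0 ⇒ t < T₀ + ℓ₀`; `Fⱼ ≠ 0 ⇒ T₀ + (j−1)d < t < T₀ + jd + ℓ₀`
(`0 < j < N`); `F_N ≠ 0 ⇒ T₀ + (N−1)d < t`; `Fⱼ' ≠ 0` only on the zones
`[T₀ + id, T₀ + id + ℓ₀]`, `i ∈ {j−1, j}`, `i < N` (`j ≤ N`); and `(Fⱼ')² ≤ C₁/ℓ₀²`
(`HelperCutoffFamilyAux.sum_sq_telescope`, `LogCutoff.exists_abs_deriv_smoothTransition_le`).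
[folklore] -/
theorem helper_cutoffFamily_profiles :
    ∃ C₁ : ℝ, 0 < C₁ ∧ ∀ (ℓ₀ d T₀ : ℝ) (N : ℕ), 1 ≤ ℓ₀ → ℓ₀ ≤ d → 2 ≤ N →
      ∃ F : ℕ → ℝ → ℝ,
        (∀ j, ContDiff ℝ ∞ (F j)) ∧
        (∀ t, ∑ j ∈ Finset.range (N + 1), F j t ^ 2 = 1) ∧
        (∀ t, t ≤ T₀ → F 0 t = 1 ∧ ∀ j, 0 < j → F j t = 0) ∧
        (∀ t, T₀ + (N - 1) * d + ℓ₀ ≤ t → F N t = 1 ∧ ∀ j, j < N → F j t = 0) ∧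
        (∀ t, F 0 t ≠ 0 → t < T₀ + ℓ₀) ∧
        (∀ (j : ℕ) (t : ℝ), 0 < j → j < N → F j t ≠ 0 →
          T₀ + (j - 1) * d < t ∧ t < T₀ + j * d + ℓ₀) ∧
        (∀ t, F N t ≠ 0 → T₀ + (N - 1) * d < t) ∧
        (∀ (j : ℕ) (t : ℝ), j ≤ N → deriv (F j) t ≠ 0 →
          ∃ i : ℕ, i < N ∧ (i = j ∨ i + 1 = j) ∧ T₀ + i * d ≤ t ∧ t ≤ T₀ + i * d + ℓ₀) ∧
        (∀ (j : ℕ) (t : ℝ), deriv (F j) t ^ 2 ≤ C₁ / ℓ₀ ^ 2) := by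
  obtain ⟨B, hB⟩ := LogCutoff.exists_abs_deriv_smoothTransition_le
  refine ⟨Real.pi ^ 2 * B ^ 2 + 1, by positivity, fun ℓ₀ d T₀ N hℓ hℓd hN ↦ ?_⟩
  have hℓ0 : 0 < ℓ₀ := by linarith
  have hd0 : 0 ≤ d := by linarith
  -- the grid, the steps and the family
  set a : ℕ → ℝ := fun i ↦ T₀ + i * d with ha
  set θ : ℕ → ℝ → ℝ := fun i t ↦ Real.smoothTransition ((t - a i) / ℓ₀) with hθ
  set F : ℕ → ℝ → ℝ := fun j t ↦
    if j = 0 then Real.cos (Real.pi / 2 * θ 0 t)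
    else if j < N then Real.sin (Real.pi / 2 * θ (j - 1) t) * Real.cos (Real.pi / 2 * θ j t)
    else Real.sin (Real.pi / 2 * θ (N - 1) t) with hF
  -- grid bookkeeping
  have ha_ge : ∀ i, T₀ ≤ a i := fun i ↦ by
    simp only [ha]; nlinarith [(Nat.cast_nonneg i : (0 : ℝ) ≤ i)]
  have ha_mono : ∀ i k : ℕ, i ≤ k → a i ≤ a k := fun i k hik ↦ by
    simp only [ha]
    have : (i : ℝ) ≤ k := by exact_mod_cast hik
    nlinarith
  have ha_succ : ∀ i : ℕ, a i + ℓ₀ ≤ a (i + 1) := fun i ↦ by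
    simp only [ha]; push_cast; linarith
  have haN : a (N - 1) = T₀ + (N - 1) * d := by
    simp only [ha]; rw [Nat.cast_pred (by omega)]
  -- the key implication `θ_{i+1} ≠ 0 ⇒ θ_i = 1`
  have hkey : ∀ (i : ℕ) (t : ℝ), θ (i + 1) t ≠ 0 → θ i t = 1 := fun i t h ↦
    HelperCutoffFamilyAux.step_eq_one hℓ0
      ((ha_succ i).trans (HelperCutoffFamilyAux.lt_of_step_ne_zero hℓ0 h).le)
  -- the three shapes of `F j`
  have hF0 : F 0 = fun t ↦ Real.cos (Real.pi / 2 * θ 0 t) := by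
    funext t; simp [hF]
  have hFmid : ∀ j, 0 < j → j < N →
      F j = fun t ↦ Real.sin (Real.pi / 2 * θ (j - 1) t) * Real.cos (Real.pi / 2 * θ j t) := by
    intro j hj hjN; funext t; simp [hF, hj.ne', hjN]
  have hFN : ∀ j, N ≤ j → F j = fun t ↦ Real.sin (Real.pi / 2 * θ (N - 1) t) := by
    intro j hj; funext t; simp [hF, show j ≠ 0 by omega, not_lt.2 hj]
  -- the derivative factors `Xᵢ(t) = π/2 · η'((t − aᵢ)/ℓ₀)/ℓ₀` and their bound
  have hX : ∀ (i : ℕ) (t : ℝ),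
      |Real.pi / 2 * (deriv Real.smoothTransition ((t - a i) / ℓ₀) * (1 / ℓ₀))| ≤
        Real.pi / 2 * B / ℓ₀ := fun i t ↦ HelperCutoffFamilyAux.abs_dstep_le hB hℓ0 _
  -- derivatives of the three shapes
  have hD0 : ∀ t, HasDerivAt (F 0)
      (-Real.sin (Real.pi / 2 * θ 0 t) *
        (Real.pi / 2 * (deriv Real.smoothTransition ((t - a 0) / ℓ₀) * (1 / ℓ₀)))) t := fun t ↦ by
    rw [hF0]; exact HelperCutoffFamilyAux.hasDerivAt_cos_step (a 0) ℓ₀ t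
  have hDmid : ∀ j, 0 < j → j < N → ∀ t, HasDerivAt (F j)
      (Real.cos (Real.pi / 2 * θ (j - 1) t) *
          (Real.pi / 2 * (deriv Real.smoothTransition ((t - a (j - 1)) / ℓ₀) * (1 / ℓ₀))) *
          Real.cos (Real.pi / 2 * θ j t) +
        Real.sin (Real.pi / 2 * θ (j - 1) t) *
          (-Real.sin (Real.pi / 2 * θ j t) *
            (Real.pi / 2 * (deriv Real.smoothTransition ((t - a j) / ℓ₀) * (1 / ℓ₀))))) t := by
    intro j hj hjN t
    rw [hFmid j hj hjN]
    exact (HelperCutoffFamilyAux.hasDerivAt_sin_step (a (j - 1)) ℓ₀ t).mul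
      (HelperCutoffFamilyAux.hasDerivAt_cos_step (a j) ℓ₀ t)
  have hDN : ∀ j, N ≤ j → ∀ t, HasDerivAt (F j)
      (Real.cos (Real.pi / 2 * θ (N - 1) t) *
        (Real.pi / 2 * (deriv Real.smoothTransition ((t - a (N - 1)) / ℓ₀) * (1 / ℓ₀)))) t := by
    intro j hj t
    rw [hFN j hj]; exact HelperCutoffFamilyAux.hasDerivAt_sin_step (a (N - 1)) ℓ₀ t
  refine ⟨F, ?_, ?_, ?_, ?_, ?_, ?_, ?_, ?_, ?_⟩
  · -- smoothness
    intro j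
    rcases Nat.eq_zero_or_pos j with rfl | hj
    · rw [hF0]; exact HelperCutoffFamilyAux.contDiff_cos_step (a 0) ℓ₀
    · rcases lt_or_ge j N with hjN | hjN
      · rw [hFmid j hj hjN]
        exact (HelperCutoffFamilyAux.contDiff_sin_step (a (j - 1)) ℓ₀).mul
          (HelperCutoffFamilyAux.contDiff_cos_step (a j) ℓ₀)
      · rw [hFN j hjN]; exact HelperCutoffFamilyAux.contDiff_sin_step (a (N - 1)) ℓ₀
  · -- squares sum to one
    intro t
    exact HelperCutoffFamilyAux.sum_sq_telescope N (fun i ↦ θ i t) (by omega)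
      (fun i hi ↦ hkey i t hi)
  · -- plateau below `T₀`
    intro t ht
    have hθ0 : ∀ i, θ i t = 0 := fun i ↦
      HelperCutoffFamilyAux.step_eq_zero hℓ0 (ht.trans (ha_ge i))
    refine ⟨by simp [hF, hθ0], fun j hj ↦ ?_⟩
    simp [hF, hθ0, hj.ne']
  · -- plateau above `T₀ + (N-1)d + ℓ₀`
    intro t ht
    rw [← haN] at ht
    have hθ1 : ∀ i, i ≤ N - 1 → θ i t = 1 := fun i hi ↦
      HelperCutoffFamilyAux.step_eq_one hℓ0 (by linarith [ha_mono i (N - 1) hi])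
    refine ⟨?_, fun j hj ↦ ?_⟩
    · simp [hF, show N ≠ 0 by omega, hθ1 (N - 1) le_rfl]
    · rcases Nat.eq_zero_or_pos j with rfl | hj0
      · simp [hF, hθ1 0 (by omega)]
      · simp [hF, hj0.ne', hj, hθ1 j (by omega)]
  · -- support of `F 0`
    intro t ht
    rw [hF0] at ht
    have h1 : θ 0 t ≠ 1 := fun h ↦ ht (by simp [h])
    have := HelperCutoffFamilyAux.lt_of_step_ne_one hℓ0 h1
    simpa [ha] using this
  · -- support of `F j`, `0 < j < N`
    intro j t hj hjN ht
    rw [hFmid j hj hjN] at ht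
    have h1 : θ (j - 1) t ≠ 0 := fun h ↦ ht (by simp [h])
    have h2 : θ j t ≠ 1 := fun h ↦ ht (by simp [h])
    have h1' := HelperCutoffFamilyAux.lt_of_step_ne_zero hℓ0 h1
    have h2' := HelperCutoffFamilyAux.lt_of_step_ne_one hℓ0 h2
    simp only [ha] at h1' h2'
    rw [Nat.cast_pred hj] at h1'
    exact ⟨h1', h2'⟩
  · -- support of `F N`
    intro t ht
    rw [hFN N le_rfl] at ht
    have h1 : θ (N - 1) t ≠ 0 := fun h ↦ ht (by simp [h])
    have h1' := HelperCutoffFamilyAux.lt_of_step_ne_zero hℓ0 h1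
    rwa [haN] at h1'
  · -- the derivative lives in the zones
    intro j t hjN hD
    have zone : ∀ i : ℕ, deriv Real.smoothTransition ((t - a i) / ℓ₀) ≠ 0 →
        T₀ + i * d ≤ t ∧ t ≤ T₀ + i * d + ℓ₀ := fun i hi ↦
      HelperCutoffFamilyAux.mem_zone_of_deriv_ne_zero hℓ0 hi
    rcases Nat.eq_zero_or_pos j with rfl | hj
    · rw [(hD0 t).deriv] at hD
      have h : deriv Real.smoothTransition ((t - a 0) / ℓ₀) ≠ 0 := fun h ↦ hD (by simp [h])
      exact ⟨0, by omega, Or.inl rfl, zone 0 h⟩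
    · rcases lt_or_ge j N with hjN' | hjN'
      · rw [(hDmid j hj hjN' t).deriv] at hD
        by_cases h : deriv Real.smoothTransition ((t - a (j - 1)) / ℓ₀) = 0
        · have h' : deriv Real.smoothTransition ((t - a j) / ℓ₀) ≠ 0 := fun h' ↦ hD (by simp [h, h'])
          exact ⟨j, hjN', Or.inl rfl, zone j h'⟩
        · exact ⟨j - 1, by omega, Or.inr (by omega), zone (j - 1) h⟩
      · have hjE : j = N := le_antisymm hjN hjN'
        subst hjE
        rw [(hDN j le_rfl t).deriv] at hD
        have h : deriv Real.smoothTransition ((t - a (j - 1)) / ℓ₀) ≠ 0 := fun h ↦ hD (by simp [h])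
        exact ⟨j - 1, by omega, Or.inr (by omega), zone (j - 1) h⟩
  · -- the derivative bound
    intro j t
    have hβ : 0 ≤ Real.pi / 2 * B / ℓ₀ := le_trans (abs_nonneg _) (hX 0 t)
    have hfin : ∀ D : ℝ, |D| ≤ 2 * (Real.pi / 2 * B / ℓ₀) →
        D ^ 2 ≤ (Real.pi ^ 2 * B ^ 2 + 1) / ℓ₀ ^ 2 := by
      intro D hD
      have h1 : D ^ 2 ≤ (2 * (Real.pi / 2 * B / ℓ₀)) ^ 2 := by
        rw [← sq_abs D]; exact pow_le_pow_left₀ (abs_nonneg D) hD 2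
      have h2 : (2 * (Real.pi / 2 * B / ℓ₀)) ^ 2 = Real.pi ^ 2 * B ^ 2 / ℓ₀ ^ 2 := by
        field_simp
      rw [h2] at h1
      exact h1.trans (div_le_div_of_nonneg_right (by linarith) (sq_nonneg _))
    apply hfin
    rcases Nat.eq_zero_or_pos j with rfl | hj
    · rw [(hD0 t).deriv]
      exact ((HelperCutoffFamilyAux.abs_trig_mul_le _ _).1.trans (hX 0 t)).trans (by linarith)
    · rcases lt_or_ge j N with hjN | hjN
      · rw [(hDmid j hj hjN t).deriv]
        refine (abs_add_le _ _).trans ?_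
        have e1 : |Real.cos (Real.pi / 2 * θ (j - 1) t) *
            (Real.pi / 2 * (deriv Real.smoothTransition ((t - a (j - 1)) / ℓ₀) * (1 / ℓ₀))) *
            Real.cos (Real.pi / 2 * θ j t)| ≤ Real.pi / 2 * B / ℓ₀ := by
          rw [abs_mul]
          exact (mul_le_of_le_one_right (abs_nonneg _) (Real.abs_cos_le_one _)).trans
            ((HelperCutoffFamilyAux.abs_trig_mul_le _ _).2.trans (hX (j - 1) t))
        have e2 : |Real.sin (Real.pi / 2 * θ (j - 1) t) *
            (-Real.sin (Real.pi / 2 * θ j t) *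
              (Real.pi / 2 * (deriv Real.smoothTransition ((t - a j) / ℓ₀) * (1 / ℓ₀))))| ≤
            Real.pi / 2 * B / ℓ₀ := by
          rw [abs_mul]
          exact (mul_le_of_le_one_left (abs_nonneg _) (Real.abs_sin_le_one _)).trans
            ((HelperCutoffFamilyAux.abs_trig_mul_le _ _).1.trans (hX j t))
        linarith
      · rw [(hDN j hjN t).deriv]
        exact ((HelperCutoffFamilyAux.abs_trig_mul_le _ _).2.trans (hX (N - 1) t)).trans (by linarith)


end Summit.SmoothPoincare4.SmoothPoincare4.Theorems

end
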